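import Summits.Ventures.PercRepro.S1CoreCapEightOne
import Summits.Ventures.PercRepro.S1CoreCapEightZero
import Summits.Ventures.PercRepro.S1CoreCapSevenTwo
import Summits.Ventures.PercRepro.S1CoreCapSixZeroHeavy

/-!
# PercRepro — THE EXACT VALUE `Q*(8) = 23`: ONE BIG LINE (p1, gen 29)

The sharpening of `S1CoreCapEightOne` from `25` to `23` — the second loose step of the crude instance
(`proofs/P1-S4-CAPBRIDGE.md` §19, §21). The crude count takes the big line `A` alone as the prefix; here the
prefix is a PLANE through `A`. (a) Some 3-point line meets `A`: the plane on the two (`Seven.exists_plane`) has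
`c ∈ {6, …, 9}` points and `f₀` fat points; inside it `C(|A|, 2) + 3 · #(3-lines) ≤ C(c, 2)` (the pair bound
`Seven.sum_choose_two_le` with `A` counted) and `Σ fat ≤ f₀ (c − 1)/2` (`Seven.sum_fat_plane_le₃`); outside it
the lines are thin over the plane with budget `11 − c − f₀` (`budget_over_plane₈`). The table over
`(|A|, c, f₀)` reads `≤ 23` (`sum_cap_le_twenty_three_of_one_big_meet`; maximum `23` at `c = 6`, `f₀ ∈ {1, 2}`).
(b) No line meets `A`: the other lines obey the spec's cost clause at nullity `10 − |A| − fat A ≤ 6` (prepend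
`A`: its rank increment is `2`, its weight `≥ 4`), so they are a no-big-line configuration at nullity `6`, of cap
`≤ 16` (`FourCap.sum_cap_le_sixteen_of_no_big`), and the whole is `≤ 5 + 16` (`sum_cap_le_twenty_one_of_one_big_disjoint`).
Hence `sum_cap_le_twenty_three_of_one_big`. Axioms: standard.
-/

namespace PercRepro

namespace S1

namespace FourCap

namespace Eight

open Seven

variable {β : Type} [DecidableEq β]

section OneBigSharp

variable {w : β → ℕ} {ls : Finset (Finset β)}
  (h1 : ∀ L ∈ ls, ∀ v ∈ L, w v = 1 ∨ w v = 2)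
  (h2 : ∀ L ∈ ls, 3 ≤ L.card ∧ wsum w L ≤ 5)
  (h3 : ∀ L ∈ ls, ∀ L' ∈ ls, L ≠ L' → (L ∩ L').card ≤ 1)
  (h4 : ∀ l : List (Finset β), l.Nodup → (∀ L ∈ l, L ∈ ls) → wsum w (unionL l) ≤ 8 + lineRank l)
  (h5 : ∀ l : List (Finset β), l.Nodup → (∀ L ∈ l, L ∈ ls) → lineRank l ≤ 3 → (unionL l).card ≤ 9)
  {A : Finset β} (hA : A ∈ ls) (cA : 4 ≤ A.card) (hrest : ∀ L ∈ ls, L ≠ A → L.card = 3)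

include h1 h2 h3 h4 h5 hA cA hrest in
/-- **One big line met by a 3-point line: cap sum `≤ 23`** — the plane on the two has `c ≥ 6` points; inside
it the pair bound and the fat bound, outside it a thin family at budget `11 − c − f₀`. -/
theorem sum_cap_le_twenty_three_of_one_big_meet {L₀ : Finset β} (hL₀ : L₀ ∈ ls) (hL₀A : L₀ ≠ A)
    (hint : (L₀ ∩ A).card = 1) : ∑ L ∈ ls, capPaper L.card (fat w L) ≤ 23 := by
  have h2' := two_le_card_of_spec₇ h2
  obtain ⟨l, hnd, hls, hr, hsub, hmax⟩ := exists_plane ls _ [L₀, A] le_rfl (by simp [hL₀A])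
    (by simp [hA, hL₀]) (by rw [lineRank_pair_eq_three (h2' A hA) (h2' L₀ hL₀) hint])
  have hc9 : (unionL l).card ≤ 9 := card_plane_le_nine h5 hnd hls hr
  have hAl : A ∈ l := hsub A (by simp)
  have hL₀l : L₀ ∈ l := hsub L₀ (by simp)
  -- the plane has at least six points
  have hc6 : 6 ≤ (unionL l).card := by
    have hsub2 : L₀ ∪ A ⊆ unionL l := by
      intro v hv
      rcases Finset.mem_union.1 hv with h | h
      · exact mem_unionL_iff.2 ⟨L₀, hL₀l, h⟩
      · exact mem_unionL_iff.2 ⟨A, hAl, h⟩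
    have hcU := Finset.card_le_card hsub2
    have hu := Finset.card_union_add_card_inter L₀ A
    have := hrest L₀ hL₀ hL₀A
    omega
  -- the lines of the plane other than `A` are 3-point lines
  have hl3 : ∀ X ∈ l, X ≠ A → X.card = 3 := fun X hX hXA => hrest X (hls X hX) hXA
  -- inside the plane: the pair bound with `A` counted
  have hpairs := sum_choose_two_le l.toFinset (fun X hX X' hX' hne =>
    h3 X (hls X (List.mem_toFinset.1 hX)) X' (hls X' (List.mem_toFinset.1 hX')) hne)
  rw [← unionL_eq_biUnion] at hpairs
  have hAf : A ∈ l.toFinset := List.mem_toFinset.2 hAl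
  have hS3 : ∀ X ∈ l.toFinset.erase A, X.card.choose 2 = 3 := by
    intro X hX
    rw [hl3 X (List.mem_toFinset.1 (Finset.mem_of_mem_erase hX)) (Finset.ne_of_mem_erase hX)]
    rfl
  rw [← Finset.add_sum_erase _ _ hAf, Finset.sum_congr rfl hS3, Finset.sum_const_nat (m := 3) (fun _ _ => rfl)]
    at hpairs
  -- inside the plane: the fat points
  have hfatin := sum_fat_plane_le₃ w l (fun X hX => (h2 X (hls X hX)).1)
    (fun X hX X' hX' hne => h3 X (hls X hX) X' (hls X' hX') hne)
  -- outside the plane: a thin family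
  set T := ls.filter (fun L => L ∉ l) with hT
  have hTmem : ∀ L ∈ T, L ∈ ls ∧ L ∉ l := fun L hL => Finset.mem_filter.1 hL
  have hT3 : ∀ L ∈ T, L.card = 3 := fun L hL =>
    hrest L (hTmem L hL).1 (fun h => (hTmem L hL).2 (h ▸ hAl))
  have hk : ∀ t : List (Finset β), t.Nodup → (∀ L ∈ t, L ∈ T) →
      freeCountR (unionL l) t + fat w (unionLR (unionL l) t \ unionL l) ≤
        11 - (unionL l).card - fat w (unionL l) := by
    intro t hndt hlt
    have hb := budget_over_plane₈ h1 h2 h4 hr t (by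
      rw [List.nodup_append']
      exact ⟨hndt, hnd, fun L hLt hLl => (hTmem L (hlt L hLt)).2 hLl⟩)
      (fun L hL => by
        rcases List.mem_append.1 hL with hL | hL
        · exact (hTmem L (hlt L hL)).1
        · exact hls L hL)
      (fun L hL => hT3 L (hlt L hL))
    omega
  have hthin := two_mul_sum_cap_thin_le w (unionL l) T
    (fun L hL => ⟨hT3 L hL, hmax L (hTmem L hL).1 (hTmem L hL).2⟩)
    (fun L hL L' hL' hne => h3 L (hTmem L hL).1 L' (hTmem L' hL').1 hne)
    (fun L hL => h1 L (hTmem L hL).1) (fun L hL => (h2 L (hTmem L hL).1).2) hk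
  -- `c + f₀ ≤ 11`
  have hcost : (unionL l).card + fat w (unionL l) ≤ 11 := by
    have := budget_over_plane₈ h1 h2 h4 hr [] (by simpa using hnd) (by simpa using hls) (by simp)
    omega
  -- the split of the sum
  have hsplit := Finset.sum_filter_add_sum_filter_not ls (fun L => L ∈ l) (fun L => capPaper L.card (fat w L))
  have hfil : ls.filter (fun L => L ∈ l) = l.toFinset := by
    ext L
    simp only [Finset.mem_filter, List.mem_toFinset]
    exact ⟨fun h => h.2, fun h => ⟨hls L h, h⟩⟩
  rw [hfil, ← hT] at hsplit
  rw [← hsplit, ← Finset.add_sum_erase _ _ hAf, capPaper_big_eq h1 h2 hA cA]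
  have hcapl : ∀ X ∈ l.toFinset.erase A, capPaper X.card (fat w X) = 1 + fat w X := by
    intro X hX
    have hX' := hls X (List.mem_toFinset.1 (Finset.mem_of_mem_erase hX))
    have := wsum_eq_card_add_fat w X (h1 X hX')
    have := (h2 X hX').2
    have hX3 := hl3 X (List.mem_toFinset.1 (Finset.mem_of_mem_erase hX)) (Finset.ne_of_mem_erase hX)
    rw [hX3, capPaper_three_eq' (by omega)]
  rw [Finset.sum_congr rfl hcapl, Finset.sum_add_distrib, Finset.sum_const_nat (m := 1) (fun _ _ => rfl),
    Nat.mul_one]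
  rw [← Finset.add_sum_erase _ _ hAf] at hfatin
  rw [Nat.choose_two_right] at hpairs
  -- the shape of `A` and the table
  have hwA := wsum_eq_card_add_fat w A (h1 A hA)
  have hA5 := (h2 A hA).2
  have hA5' : A.card ≤ 5 := by omega
  generalize hc : (unionL l).card = c at hpairs hfatin hthin hcost hc6 hc9
  generalize hf : fat w (unionL l) = f₀ at hfatin hthin hcost
  generalize (l.toFinset.erase A).card = s at hpairs ⊢
  generalize ∑ X ∈ l.toFinset.erase A, fat w X = sf at hfatin ⊢
  generalize ∑ L ∈ T, capPaper L.card (fat w L) = sT at hthin ⊢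
  generalize fat w A = fA at hwA hA5 hfatin ⊢
  generalize hkA : A.card = kA at hwA hA5 hA5' cA hpairs ⊢
  have hf5 : f₀ ≤ 5 := by omega
  interval_cases c <;> interval_cases f₀ <;> interval_cases kA <;> simp only [Nat.choose] at hpairs <;> omega

include h1 h2 h3 h4 hA cA hrest in
/-- **One big line met by no other line: cap sum `≤ 21`** — the other lines form a no-big-line configuration at
nullity `10 − |A| − fat A ≤ 6`, of cap `≤ 16`. -/
theorem sum_cap_le_twenty_one_of_one_big_disjoint (hdisj : ∀ L ∈ ls, L ≠ A → (L ∩ A).card = 0) :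
    ∑ L ∈ ls, capPaper L.card (fat w L) ≤ 21 := by
  set T := ls.erase A with hT
  have hTmem : ∀ L ∈ T, L ∈ ls ∧ L ≠ A := fun L hL => ⟨Finset.mem_of_mem_erase hL, Finset.ne_of_mem_erase hL⟩
  have hsum := Finset.add_sum_erase ls (fun L => capPaper L.card (fat w L)) hA
  rw [← hT] at hsum
  rw [← hsum, capPaper_big_eq h1 h2 hA cA]
  -- the cost clause of `T` at nullity `6`: prepend `A`
  have h4' : ∀ t : List (Finset β), t.Nodup → (∀ L ∈ t, L ∈ T) → wsum w (unionL t) ≤ 6 + lineRank t := by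
    intro t hndt hlt
    have hAt : A ∉ t := fun h => (hTmem A (hlt A h)).2 rfl
    have hc := h4 (A :: t) (List.nodup_cons.2 ⟨hAt, hndt⟩) (fun L hL => by
      rcases List.mem_cons.1 hL with rfl | hL
      · exact hA
      · exact (hTmem L (hlt L hL)).1)
    -- `A` meets no line of `t`
    have hAi : (A ∩ unionL t).card = 0 := by
      rw [Finset.card_eq_zero, Finset.eq_empty_iff_forall_notMem]
      intro p hp
      obtain ⟨hpA, hpU⟩ := Finset.mem_inter.1 hp
      obtain ⟨L, hL, hpL⟩ := mem_unionL_iff.1 hpU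
      have h0 := hdisj L (hTmem L (hlt L hL)).1 (hTmem L (hlt L hL)).2
      rw [Finset.card_eq_zero] at h0
      exact Finset.notMem_empty p (h0 ▸ Finset.mem_inter.2 ⟨hpL, hpA⟩)
    have hAd := Finset.card_sdiff_add_card_inter A (unionL t)
    have hws := wsum_unionL_cons w A t
    have hwA := wsum_eq_card_add_fat w (A \ unionL t) (fun v hv => h1 A hA v (Finset.mem_sdiff.1 hv).1)
    simp only [lineRank] at hc
    rw [hws] at hc
    omega
  have hall' : ∀ L ∈ T, L.card = 3 := fun L hL => hrest L (hTmem L hL).1 (hTmem L hL).2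
  have h16 := sum_cap_le_sixteen_of_no_big (fun L hL => h1 L (hTmem L hL).1) (fun L hL => h2 L (hTmem L hL).1)
    (fun L hL L' hL' hne => h3 L (hTmem L hL).1 L' (hTmem L' hL').1 hne) h4' hall'
  have hwA := wsum_eq_card_add_fat w A (h1 A hA)
  have hA5 := (h2 A hA).2
  omega

include h1 h2 h3 h4 h5 hA cA hrest in
/-- **One big line at nullity `8`: cap sum `≤ 23`** (sharpening `sum_cap_le_twenty_five_of_one_big`): met by a
3-point line `≤ 23`, met by none `≤ 21`. -/
theorem sum_cap_le_twenty_three_of_one_big : ∑ L ∈ ls, capPaper L.card (fat w L) ≤ 23 := by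
  by_cases hmeet : ∃ L ∈ ls, L ≠ A ∧ (L ∩ A).card = 1
  · obtain ⟨L₀, hL₀, hL₀A, hint⟩ := hmeet
    exact sum_cap_le_twenty_three_of_one_big_meet h1 h2 h3 h4 h5 hA cA hrest hL₀ hL₀A hint
  · push Not at hmeet
    refine (sum_cap_le_twenty_one_of_one_big_disjoint h1 h2 h3 h4 hA cA hrest (fun L hL hLA => ?_)).trans
      (by norm_num)
    have := hmeet L hL hLA
    have := h3 L hL A hA hLA
    omega

end OneBigSharp

end Eight

end FourCap

end S1

end PercRepro
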